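import Summits.QuantumFields.YangMills.Theorems.BalabanUVNodesN15KingModelGradCellOscillationKernel
import HarnessLib

/-!
# N15 (NE2), King-model rung — THE CELL-OSCILLATION ROW OF THE KING GRADIENT, part 2∕3 (LEVELS): the (1,0) profile summed over the NEAR ball costs `n′^{d+1}·L^{−k}`,
# the (1,1) profile summed over the FAR region costs `n′^{d+1}·(k+2)` — both UNIFORM in the refinement `m`

WHY ∕ WHAT.  The two lattice estimates behind part 3's row (see part 1's header for the programme): ★ `nearLevels_sum_le` — on `Tor (fine n′ M)`, `n′ = L^mL^k`,
`Σ_{|y−x|<2L^m} Σ_{i<k+m} (L^d)^i e^{−δ₁|x−y|L^i∕n′} ≤ (2·5^{d+1} + 2(8(d+1)∕δ₁)^{d+1})·n′^{d+1}·L^{−k}` (levels `i ≤ k` by n15-e Ψ-a `card_ball_tdistT_le`, levels `i > k` by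
n15-e V-b `levelShell_sum_le` at `ε = 0`); ★ `farLevels_sum_le` — `Σ_{|y−x|≥L^m} Σ_{i<k+m} (L^{d+1})^i e^{−δ₁|x−y|L^i∕n′} ≤ 2(16(d+1)∕δ₁)^{d+1}(1 + (1 − e^{−δ₁∕2})⁻¹)·(k+2)·n′^{d+1}`
(the excluded ball pays `e^{−(δ₁∕2)L^{i−k}}` per level: the fine levels die geometrically, the coarse ones count `k + 1` — part 1 `levelFar_sum_le`); + `nfine_eq_pow`,
`level_alg_near`, `level_alg_far` (the level algebra).  The profiles themselves are n15-e's R-c `fullPropD_profile_unif` and V-a `fullPropDD_profile_decay_unif` (consumed in part 3).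
HONEST FRAMING ∕ LIMITS.  Count-neutral kernel ∕ lattice bookkeeping on King's `A = 0` MODEL (template literature — C. King's scalar U(1)-Higgs model on finite tori,
[King1986] (2.13)–(2.17) p. 653, Prop. 3.7 (3.63) p. 663, (4.42)–(4.44) p. 675), NOT Bałaban's covariant `G(U)`; [Balaban1985BackgroundPropagators] (3.35) p. 396, (3.52) p. 400,
(3.62)–(3.65) p. 402 are cited as the MECHANISM of the first-order dressed pair only.  NE2⁺ is NOT PRINTED and NOT proved here; N15 is NOT discharged; K3⁸
OPEN 0∕2; counts of record UNMOVED (typed 28∕28 · discharged 5∕27 · A 5∕28); one finite torus at fixed spacings per index — NOT ℝ⁴ ∕ infinite volume ∕ OS ∕ mass gap ∕ Clay.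
0 `sorry`, 0 `def`, standard axioms.  Cell `pub-ymgap`, seat `pub-ymgap-dag-n15-d` (R134 N15 NE2 s3, King-model rung), generation 20; `--kind proof --supports
stmt-QuantumFields-27366 --as helper` (K3⁸).  Consumer: dag-n15-a programme M-III, III-B `hasMaj_idef_bgPair_of_sandwichRows` hypothesis `hDGc` («ROW (go)» INBOX l.≈42090).
-/

noncomputable section

open scoped BigOperators
open Finset

namespace Summit.QuantumFields.YangMills.BalabanUVNodes.N15.KingModel.CellOsc

open Literature.MathematicalPhysics.QuantumFieldTheory.Balaban1983to89
open Literature.MathematicalPhysics.QuantumFieldTheory.Balaban1983to89.B11SectG (BlockNorm HasMaj hasMaj_sum)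
open Literature.MathematicalPhysics.QuantumFieldTheory.Balaban1983to89.B11AxialTransport190 (abs_le_loc_ofBlocks loc_ofBlocks_le)
open Literature.MathematicalPhysics.QuantumFieldTheory.Balaban1983to89.T4EtaRateDefect (idef idef_apply)
open Literature.MathematicalPhysics.QuantumFieldTheory.Balaban1983to89.T4EtaRateCoeffDefect (pull pull_apply blockAvg idef_mulOp_eq)
open Literature.MathematicalPhysics.QuantumFieldTheory.Balaban1983to89.B6Prop26Gluing (mulOp mulOp_apply)
open Literature.MathematicalPhysics.QuantumFieldTheory.Balaban1983to89.B5Prop11Plancherel (Tor fine unitVec)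
open Literature.MathematicalPhysics.QuantumFieldTheory.Balaban1983to89.B4TorusKernel.MultiPeriod (circAbs circAbs_le_abs)
open Literature.MathematicalPhysics.QuantumFieldTheory.Balaban1983to89.B4Sect5Torus (tdist)
open Literature.MathematicalPhysics.QuantumFieldTheory.Balaban1983to89.B6BondEliminationTorus (tdist_le_of_forall)
open Literature.MathematicalPhysics.QuantumFieldTheory.Balaban1983to89.B6UnitTorusCarrier (unitTorusGeo)
open Literature.MathematicalPhysics.QuantumFieldTheory.King1986 (aK aK_pos)
open Literature.MathematicalPhysics.QuantumFieldTheory.King1986.Torus (fineOp constrainedProp blockOf tdistT tdistT_nonneg tdistT_symm tdistT_self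
  tdistT_triangle toSite one_le_period)
open Summit.QuantumFields.YangMills.BalabanUVNodes.N15.VectorPiece (kingPr kingPrV kingPr_val kingPrV_eq blkFine blkFine_comp_kingPrV tensorId tensorId_apply)
open Summit.QuantumFields.YangMills.BalabanUVNodes.N15.TwoGrid
open Summit.QuantumFields.YangMills.BalabanUVNodes.N15KingModelRung.Curved

variable {d : ℕ} (L : ℕ) [NeZero L] (M : Fin (d + 1) → ℕ) [∀ μ, NeZero (M μ)] (k m : ℕ)

/-! ## §4 The near cells: the (1,0) profile summed over the fine ball of radius `2L^m` costs `n′^{d+1}·L^{−k}` -/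

omit [NeZero L] [∀ μ, NeZero (M μ)] in
/-- the fine period `n′ = L^m·L^k = L^{k+m}`. [folklore] -/
theorem nfine_eq_pow : L ^ m * L ^ k = L ^ (k + m) := by rw [pow_add, mul_comm]

omit [NeZero L] [∀ μ, NeZero (M μ)] in
/-- level algebra, near∕fine levels: `(q^d)·(A·n∕(δ·q))^{d+1} = (A∕δ)^{d+1}·n^{d+1}·q⁻¹`. [folklore] -/
theorem level_alg_near {q δ A n : ℝ} (hq : 0 < q) (hδ : 0 < δ) :
    q ^ d * (A * n / (δ * q)) ^ (d + 1) = (A / δ) ^ (d + 1) * n ^ (d + 1) * q⁻¹ := by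
  have hq' : q ≠ 0 := hq.ne'
  have hδ' : δ ≠ 0 := hδ.ne'
  rw [div_pow, div_pow, mul_pow, mul_pow]
  field_simp
  ring

omit [NeZero L] [∀ μ, NeZero (M μ)] in
/-- level algebra, far levels: `q^{d+1}·(A·n∕((δ∕2)·q))^{d+1} = (2A∕δ)^{d+1}·n^{d+1}`. [folklore] -/
theorem level_alg_far {q δ A n : ℝ} (hq : 0 < q) (hδ : 0 < δ) :
    q ^ (d + 1) * (A * n / (δ / 2 * q)) ^ (d + 1) = (2 * A / δ) ^ (d + 1) * n ^ (d + 1) := by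
  have hq' : q ≠ 0 := hq.ne'
  have hδ' : δ ≠ 0 := hδ.ne'
  rw [← mul_pow, ← mul_pow]
  congr 1
  field_simp

/-- **THE NEAR LEVELS**: on the fine torus `Tor (fine n′ M)`, `n′ = L^mL^k`, for `0 < δ₁ ≤ 1` and every centre `x`:
`Σ_{|y−x| < 2L^m} Σ_{i<k+m} (L^d)^i e^{−δ₁|x−y|L^i∕n′} ≤ (2·5^{d+1} + 2(8(d+1)∕δ₁)^{d+1})·n′^{d+1}·L^{−k}` — levels `i ≤ k` by the ball count
`(4L^m + 1)^{d+1} ≤ (5L^m)^{d+1}` (n15-e `card_ball_tdistT_le`) and `Σ_{i≤k}(L^d)^i ≤ 2L^{dk}`, levels `i > k` by the whole-torus sum `2(8(d+1)n′∕(δ₁L^i))^{d+1}`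
(n15-e `levelShell_sum_le` at `ε = 0`) and `Σ_{i>k} L^{−i} ≤ L^{−k}`; uniform in `m`. [cite: King1986, Prop. 3.7 (3.63) p.663 (the scale-`j` pieces); Balaban1983RegularityDecay, §5 (5.7)–(5.8) p.594] -/
theorem nearLevels_sum_le (hd : 1 ≤ d) (hL : 2 ≤ L) {δ₁ : ℝ} (hδ0 : 0 < δ₁) (hδ1 : δ₁ ≤ 1) (x : Tor (fine (L ^ m * L ^ k) M)) :
    ∑ y ∈ univ.filter (fun y => tdistT (fine (L ^ m * L ^ k) M) x y < 2 * ((L ^ m : ℕ) : ℝ)),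
        ∑ i ∈ range (k + m), ((L : ℝ) ^ (d + 1) / (L : ℝ) ^ 2 * L) ^ i
          * Real.exp (-(δ₁ * (tdistT (fine (L ^ m * L ^ k) M) x y * (L : ℝ) ^ i / ((L ^ m * L ^ k : ℕ) : ℝ))))
      ≤ (2 * (5 : ℝ) ^ (d + 1) + 2 * (8 * ((d : ℝ) + 1) / δ₁) ^ (d + 1)) * ((L ^ m * L ^ k : ℕ) : ℝ) ^ (d + 1) * (((L : ℝ) ^ k))⁻¹ := by
  classical
  have hL1 : (1 : ℝ) < L := by exact_mod_cast (show 1 < L by omega)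
  have hL0 : (0 : ℝ) < L := by linarith
  have hn'pow : ((L ^ m * L ^ k : ℕ) : ℝ) = (L : ℝ) ^ (k + m) := by rw [nfine_eq_pow]; push_cast; ring
  have hn'0 : (0 : ℝ) < ((L ^ m * L ^ k : ℕ) : ℝ) := by rw [hn'pow]; positivity
  have hn'mk : ((L ^ m * L ^ k : ℕ) : ℝ) = (L : ℝ) ^ m * (L : ℝ) ^ k := by push_cast; ring
  have hLm : ((L ^ m : ℕ) : ℝ) = (L : ℝ) ^ m := by push_cast; ring
  have hΛ : (L : ℝ) ^ (d + 1) / (L : ℝ) ^ 2 * L = (L : ℝ) ^ d := LamL_eq_pow L hL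
  rw [hΛ, Finset.sum_comm, ← Finset.sum_filter_add_sum_filter_not (range (k + m)) (fun i => k < i)]
  have hterm0 : ∀ i (y : Tor (fine (L ^ m * L ^ k) M)), 0 ≤ ((L : ℝ) ^ d) ^ i * Real.exp (-(δ₁ * (tdistT (fine (L ^ m * L ^ k) M) x y * (L : ℝ) ^ i / ((L ^ m * L ^ k : ℕ) : ℝ)))) :=
    fun i y => by positivity
  -- fine levels `i > k`: the whole-torus sum
  have hfine : ∑ i ∈ (range (k + m)).filter (fun i => k < i), ∑ y ∈ univ.filter (fun y => tdistT (fine (L ^ m * L ^ k) M) x y < 2 * ((L ^ m : ℕ) : ℝ)),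
        ((L : ℝ) ^ d) ^ i * Real.exp (-(δ₁ * (tdistT (fine (L ^ m * L ^ k) M) x y * (L : ℝ) ^ i / ((L ^ m * L ^ k : ℕ) : ℝ))))
      ≤ 2 * (8 * ((d : ℝ) + 1) / δ₁) ^ (d + 1) * ((L ^ m * L ^ k : ℕ) : ℝ) ^ (d + 1) * ((L : ℝ) ^ k)⁻¹ := by
    have hlev : ∀ i ∈ (range (k + m)).filter (fun i => k < i), ∑ y ∈ univ.filter (fun y => tdistT (fine (L ^ m * L ^ k) M) x y < 2 * ((L ^ m : ℕ) : ℝ)),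
        ((L : ℝ) ^ d) ^ i * Real.exp (-(δ₁ * (tdistT (fine (L ^ m * L ^ k) M) x y * (L : ℝ) ^ i / ((L ^ m * L ^ k : ℕ) : ℝ))))
        ≤ 2 * (8 * ((d : ℝ) + 1) / δ₁) ^ (d + 1) * ((L ^ m * L ^ k : ℕ) : ℝ) ^ (d + 1) * ((L : ℝ) ^ i)⁻¹ := by
      intro i hi
      have hiK : i < k + m := mem_range.mp (mem_filter.mp hi).1
      have hq1 : (1 : ℝ) ≤ (L : ℝ) ^ i := one_le_pow₀ hL1.le
      have hq0 : (0 : ℝ) < (L : ℝ) ^ i := by linarith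
      have hqN : (L : ℝ) ^ i ≤ ((L ^ m * L ^ k : ℕ) : ℝ) := by rw [hn'pow]; exact pow_le_pow_right₀ hL1.le (by omega)
      have hS := levelShell_sum_le (L ^ m * L ^ k) M (q := (L : ℝ) ^ i) hq1 hqN hδ0 hδ1 le_rfl zero_le_one x
      simp only [neg_zero, Real.rpow_zero, one_mul, mul_one] at hS
      have hid : ((L : ℝ) ^ d) ^ i = ((L : ℝ) ^ i) ^ d := by rw [← pow_mul, ← pow_mul, Nat.mul_comm]
      calc ∑ y ∈ univ.filter (fun y => tdistT (fine (L ^ m * L ^ k) M) x y < 2 * ((L ^ m : ℕ) : ℝ)), ((L : ℝ) ^ d) ^ i * Real.exp (-(δ₁ * (tdistT (fine (L ^ m * L ^ k) M) x y * (L : ℝ) ^ i / ((L ^ m * L ^ k : ℕ) : ℝ))))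
          ≤ ∑ y, ((L : ℝ) ^ d) ^ i * Real.exp (-(δ₁ * (tdistT (fine (L ^ m * L ^ k) M) x y * (L : ℝ) ^ i / ((L ^ m * L ^ k : ℕ) : ℝ)))) :=
            Finset.sum_le_sum_of_subset_of_nonneg (Finset.filter_subset _ _) fun y _ _ => hterm0 i y
        _ = ((L : ℝ) ^ d) ^ i * ∑ y, Real.exp (-(δ₁ * (tdistT (fine (L ^ m * L ^ k) M) x y * (L : ℝ) ^ i / ((L ^ m * L ^ k : ℕ) : ℝ)))) := by rw [Finset.mul_sum]
        _ ≤ ((L : ℝ) ^ d) ^ i * (2 * (8 * ((d : ℝ) + 1) * ((L ^ m * L ^ k : ℕ) : ℝ) / (δ₁ * (L : ℝ) ^ i)) ^ (d + 1)) :=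
            mul_le_mul_of_nonneg_left hS (by positivity)
        _ = 2 * (((L : ℝ) ^ i) ^ d * (8 * ((d : ℝ) + 1) * ((L ^ m * L ^ k : ℕ) : ℝ) / (δ₁ * (L : ℝ) ^ i)) ^ (d + 1)) := by rw [hid]; ring
        _ = 2 * (8 * ((d : ℝ) + 1) / δ₁) ^ (d + 1) * ((L ^ m * L ^ k : ℕ) : ℝ) ^ (d + 1) * ((L : ℝ) ^ i)⁻¹ := by
            rw [level_alg_near (d := d) hq0 hδ0]; ring
    calc ∑ i ∈ (range (k + m)).filter (fun i => k < i), ∑ y ∈ univ.filter (fun y => tdistT (fine (L ^ m * L ^ k) M) x y < 2 * ((L ^ m : ℕ) : ℝ)),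
            ((L : ℝ) ^ d) ^ i * Real.exp (-(δ₁ * (tdistT (fine (L ^ m * L ^ k) M) x y * (L : ℝ) ^ i / ((L ^ m * L ^ k : ℕ) : ℝ))))
        ≤ ∑ i ∈ (range (k + m)).filter (fun i => k < i), 2 * (8 * ((d : ℝ) + 1) / δ₁) ^ (d + 1) * ((L ^ m * L ^ k : ℕ) : ℝ) ^ (d + 1) * ((L : ℝ) ^ i)⁻¹ :=
          Finset.sum_le_sum hlev
      _ = 2 * (8 * ((d : ℝ) + 1) / δ₁) ^ (d + 1) * ((L ^ m * L ^ k : ℕ) : ℝ) ^ (d + 1) * ∑ i ∈ (range (k + m)).filter (fun i => k < i), ((L : ℝ) ^ i)⁻¹ := by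
          rw [Finset.mul_sum]
      _ ≤ 2 * (8 * ((d : ℝ) + 1) / δ₁) ^ (d + 1) * ((L ^ m * L ^ k : ℕ) : ℝ) ^ (d + 1) * ((L : ℝ) ^ k)⁻¹ :=
          mul_le_mul_of_nonneg_left (fineLevels_sum_le L hL k (k + m)) (by positivity)
  -- coarse levels `i ≤ k`: the ball count
  have hball : ((univ.filter (fun y => tdistT (fine (L ^ m * L ^ k) M) x y < 2 * ((L ^ m : ℕ) : ℝ))).card : ℝ) ≤ (5 * (L : ℝ) ^ m) ^ (d + 1) := by
    have h := card_ball_tdistT_le (fine (L ^ m * L ^ k) M) x (r := 2 * ((L ^ m : ℕ) : ℝ)) (by positivity)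
    have hsub : univ.filter (fun y => tdistT (fine (L ^ m * L ^ k) M) x y < 2 * ((L ^ m : ℕ) : ℝ)) ⊆ univ.filter (fun y => tdistT (fine (L ^ m * L ^ k) M) x y ≤ 2 * ((L ^ m : ℕ) : ℝ)) := by
      intro y hy
      rw [mem_filter] at hy ⊢
      exact ⟨hy.1, hy.2.le⟩
    have hc := (Finset.card_le_card hsub).trans h
    have hfloor : ⌊2 * ((L ^ m : ℕ) : ℝ)⌋₊ = 2 * L ^ m := by
      rw [show (2 : ℝ) * ((L ^ m : ℕ) : ℝ) = ((2 * L ^ m : ℕ) : ℝ) by push_cast; ring, Nat.floor_natCast]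
    rw [hfloor] at hc
    have hc' : ((univ.filter (fun y => tdistT (fine (L ^ m * L ^ k) M) x y < 2 * ((L ^ m : ℕ) : ℝ))).card : ℝ) ≤ (((2 * (2 * L ^ m) + 1) ^ (d + 1) : ℕ) : ℝ) := by
      exact_mod_cast hc
    refine hc'.trans ?_
    push_cast
    apply pow_le_pow_left₀ (by positivity)
    have : (1 : ℝ) ≤ (L : ℝ) ^ m := one_le_pow₀ hL1.le
    linarith
  have hcoarse : ∑ i ∈ (range (k + m)).filter (fun i => ¬ k < i), ∑ y ∈ univ.filter (fun y => tdistT (fine (L ^ m * L ^ k) M) x y < 2 * ((L ^ m : ℕ) : ℝ)),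
        ((L : ℝ) ^ d) ^ i * Real.exp (-(δ₁ * (tdistT (fine (L ^ m * L ^ k) M) x y * (L : ℝ) ^ i / ((L ^ m * L ^ k : ℕ) : ℝ))))
      ≤ 2 * (5 : ℝ) ^ (d + 1) * ((L ^ m * L ^ k : ℕ) : ℝ) ^ (d + 1) * ((L : ℝ) ^ k)⁻¹ := by
    have hlev : ∀ i ∈ (range (k + m)).filter (fun i => ¬ k < i), ∑ y ∈ univ.filter (fun y => tdistT (fine (L ^ m * L ^ k) M) x y < 2 * ((L ^ m : ℕ) : ℝ)),
        ((L : ℝ) ^ d) ^ i * Real.exp (-(δ₁ * (tdistT (fine (L ^ m * L ^ k) M) x y * (L : ℝ) ^ i / ((L ^ m * L ^ k : ℕ) : ℝ)))) ≤ ((L : ℝ) ^ d) ^ i * (5 * (L : ℝ) ^ m) ^ (d + 1) := by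
      intro i _
      have h2 : 0 ≤ ((L : ℝ) ^ d) ^ i := by positivity
      calc ∑ y ∈ univ.filter (fun y => tdistT (fine (L ^ m * L ^ k) M) x y < 2 * ((L ^ m : ℕ) : ℝ)), ((L : ℝ) ^ d) ^ i * Real.exp (-(δ₁ * (tdistT (fine (L ^ m * L ^ k) M) x y * (L : ℝ) ^ i / ((L ^ m * L ^ k : ℕ) : ℝ))))
          ≤ ∑ _y ∈ univ.filter (fun y => tdistT (fine (L ^ m * L ^ k) M) x y < 2 * ((L ^ m : ℕ) : ℝ)), ((L : ℝ) ^ d) ^ i :=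
            Finset.sum_le_sum fun y _ => mul_le_of_le_one_right h2 (Real.exp_le_one_iff.mpr (by
              have := tdistT_nonneg (fine (L ^ m * L ^ k) M) x y
              have : 0 ≤ δ₁ * (tdistT (fine (L ^ m * L ^ k) M) x y * (L : ℝ) ^ i / ((L ^ m * L ^ k : ℕ) : ℝ)) := by positivity
              linarith))
        _ = ((univ.filter (fun y => tdistT (fine (L ^ m * L ^ k) M) x y < 2 * ((L ^ m : ℕ) : ℝ))).card : ℝ) * ((L : ℝ) ^ d) ^ i := by rw [sum_const, nsmul_eq_mul]
        _ ≤ (5 * (L : ℝ) ^ m) ^ (d + 1) * ((L : ℝ) ^ d) ^ i := mul_le_mul_of_nonneg_right hball h2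
        _ = ((L : ℝ) ^ d) ^ i * (5 * (L : ℝ) ^ m) ^ (d + 1) := mul_comm _ _
    have hsub : (range (k + m)).filter (fun i => ¬ k < i) ⊆ range (k + 1) := by
      intro i hi
      rw [mem_filter, mem_range] at hi
      exact mem_range.mpr (by omega)
    have hq2 : (2 : ℝ) ≤ (L : ℝ) ^ d := by
      calc (2 : ℝ) ≤ (L : ℝ) ^ 1 := by rw [pow_one]; exact_mod_cast hL
        _ ≤ (L : ℝ) ^ d := pow_le_pow_right₀ hL1.le hd
    calc ∑ i ∈ (range (k + m)).filter (fun i => ¬ k < i), ∑ y ∈ univ.filter (fun y => tdistT (fine (L ^ m * L ^ k) M) x y < 2 * ((L ^ m : ℕ) : ℝ)),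
            ((L : ℝ) ^ d) ^ i * Real.exp (-(δ₁ * (tdistT (fine (L ^ m * L ^ k) M) x y * (L : ℝ) ^ i / ((L ^ m * L ^ k : ℕ) : ℝ))))
        ≤ ∑ i ∈ (range (k + m)).filter (fun i => ¬ k < i), ((L : ℝ) ^ d) ^ i * (5 * (L : ℝ) ^ m) ^ (d + 1) := Finset.sum_le_sum hlev
      _ ≤ ∑ i ∈ range (k + 1), ((L : ℝ) ^ d) ^ i * (5 * (L : ℝ) ^ m) ^ (d + 1) :=
          Finset.sum_le_sum_of_subset_of_nonneg hsub fun i _ _ => by positivity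
      _ = (∑ i ∈ range (k + 1), ((L : ℝ) ^ d) ^ i) * (5 * (L : ℝ) ^ m) ^ (d + 1) := by rw [Finset.sum_mul]
      _ ≤ 2 * ((L : ℝ) ^ d) ^ k * (5 * (L : ℝ) ^ m) ^ (d + 1) := mul_le_mul_of_nonneg_right (geom_le_two_mul_pow hq2 k) (by positivity)
      _ = 2 * (5 : ℝ) ^ (d + 1) * ((L ^ m * L ^ k : ℕ) : ℝ) ^ (d + 1) * ((L : ℝ) ^ k)⁻¹ := by
          rw [hn'mk]
          have hLk : (L : ℝ) ^ k ≠ 0 := pow_ne_zero _ hL0.ne'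
          rw [mul_pow, mul_pow, ← pow_mul, ← pow_mul, ← pow_mul]
          field_simp
          ring
  calc ∑ i ∈ (range (k + m)).filter (fun i => k < i), ∑ y ∈ univ.filter (fun y => tdistT (fine (L ^ m * L ^ k) M) x y < 2 * ((L ^ m : ℕ) : ℝ)),
            ((L : ℝ) ^ d) ^ i * Real.exp (-(δ₁ * (tdistT (fine (L ^ m * L ^ k) M) x y * (L : ℝ) ^ i / ((L ^ m * L ^ k : ℕ) : ℝ))))
        + ∑ i ∈ (range (k + m)).filter (fun i => ¬ k < i), ∑ y ∈ univ.filter (fun y => tdistT (fine (L ^ m * L ^ k) M) x y < 2 * ((L ^ m : ℕ) : ℝ)),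
            ((L : ℝ) ^ d) ^ i * Real.exp (-(δ₁ * (tdistT (fine (L ^ m * L ^ k) M) x y * (L : ℝ) ^ i / ((L ^ m * L ^ k : ℕ) : ℝ))))
      ≤ 2 * (8 * ((d : ℝ) + 1) / δ₁) ^ (d + 1) * ((L ^ m * L ^ k : ℕ) : ℝ) ^ (d + 1) * ((L : ℝ) ^ k)⁻¹ + 2 * (5 : ℝ) ^ (d + 1) * ((L ^ m * L ^ k : ℕ) : ℝ) ^ (d + 1) * ((L : ℝ) ^ k)⁻¹ :=
        add_le_add hfine hcoarse
    _ = (2 * (5 : ℝ) ^ (d + 1) + 2 * (8 * ((d : ℝ) + 1) / δ₁) ^ (d + 1)) * ((L ^ m * L ^ k : ℕ) : ℝ) ^ (d + 1) * (((L : ℝ) ^ k))⁻¹ := by ring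

/-! ## §5 The far cells: the (1,1) profile summed outside the fine ball of radius `L^m` costs `n′^{d+1}·(k+2)` -/

/-- **THE FAR LEVELS**: `Σ_{|y−x| ≥ L^m} Σ_{i<k+m} (L^{d+1})^i e^{−δ₁|x−y|L^i∕n′} ≤ 2(32(d+1)∕δ₁)^{d+1}(1 + (1 − e^{−δ₁∕2})⁻¹)·(k+2)·n′^{d+1}` — every level pays
`e^{−(δ₁∕2)L^{i−k}}` from the excluded ball and `2(16(d+1)n′∕(δ₁L^i))^{d+1}` from the whole-torus sum; the level count is the COARSE logarithm `k + 1` plus a geometric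
tail in the finer levels (`levelFar_sum_le`); uniform in `m`. [cite: King1986, Prop. 3.7 (3.63) p.663; Balaban1983RegularityDecay, §5 (5.7)–(5.8) p.594] -/
theorem farLevels_sum_le (hL : 2 ≤ L) {δ₁ : ℝ} (hδ0 : 0 < δ₁) (hδ1 : δ₁ ≤ 1) (x : Tor (fine (L ^ m * L ^ k) M)) :
    ∑ y ∈ univ.filter (fun y => ((L ^ m : ℕ) : ℝ) ≤ tdistT (fine (L ^ m * L ^ k) M) x y),
        ∑ i ∈ range (k + m), ((L : ℝ) ^ (d + 1) / (L : ℝ) ^ 2 * L * L) ^ i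
          * Real.exp (-(δ₁ * (tdistT (fine (L ^ m * L ^ k) M) x y * (L : ℝ) ^ i / ((L ^ m * L ^ k : ℕ) : ℝ))))
      ≤ 2 * (2 * (8 * ((d : ℝ) + 1)) / δ₁) ^ (d + 1) * (1 + (1 - Real.exp (-(δ₁ / 2)))⁻¹) * ((k : ℝ) + 2) * ((L ^ m * L ^ k : ℕ) : ℝ) ^ (d + 1) := by
  classical
  have hL1 : (1 : ℝ) < L := by exact_mod_cast (show 1 < L by omega)
  have hL0 : (0 : ℝ) < L := by linarith
  have hn'pow : ((L ^ m * L ^ k : ℕ) : ℝ) = (L : ℝ) ^ (k + m) := by rw [nfine_eq_pow]; push_cast; ring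
  have hn'0 : (0 : ℝ) < ((L ^ m * L ^ k : ℕ) : ℝ) := by rw [hn'pow]; positivity
  have hn'mk : ((L ^ m * L ^ k : ℕ) : ℝ) = (L : ℝ) ^ m * (L : ℝ) ^ k := by push_cast; ring
  have hLm : ((L ^ m : ℕ) : ℝ) = (L : ℝ) ^ m := by push_cast; ring
  have hΛ : (L : ℝ) ^ (d + 1) / (L : ℝ) ^ 2 * L * L = (L : ℝ) ^ (d + 1) := LamL2_eq_pow L hL
  rw [hΛ, Finset.sum_comm]
  have hr0 : 0 < 1 - Real.exp (-(δ₁ / 2)) := by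
    have : Real.exp (-(δ₁ / 2)) < 1 := Real.exp_lt_one_iff.mpr (by linarith)
    linarith
  -- one level
  have hlev : ∀ i ∈ range (k + m), ∑ y ∈ univ.filter (fun y => ((L ^ m : ℕ) : ℝ) ≤ tdistT (fine (L ^ m * L ^ k) M) x y),
      ((L : ℝ) ^ (d + 1)) ^ i * Real.exp (-(δ₁ * (tdistT (fine (L ^ m * L ^ k) M) x y * (L : ℝ) ^ i / ((L ^ m * L ^ k : ℕ) : ℝ))))
      ≤ 2 * (2 * (8 * ((d : ℝ) + 1)) / δ₁) ^ (d + 1) * ((L ^ m * L ^ k : ℕ) : ℝ) ^ (d + 1) * Real.exp (-(δ₁ / 2 * ((L : ℝ) ^ i / (L : ℝ) ^ k))) := by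
    intro i hi
    have hiK : i < k + m := mem_range.mp hi
    have hq1 : (1 : ℝ) ≤ (L : ℝ) ^ i := one_le_pow₀ hL1.le
    have hq0 : (0 : ℝ) < (L : ℝ) ^ i := by linarith
    have hqN : (L : ℝ) ^ i ≤ ((L ^ m * L ^ k : ℕ) : ℝ) := by rw [hn'pow]; exact pow_le_pow_right₀ hL1.le (by omega)
    have hδh0 : 0 < δ₁ / 2 := by linarith
    have hδh1 : δ₁ / 2 ≤ 1 := by linarith
    have hSum := levelShell_sum_le (L ^ m * L ^ k) M (q := (L : ℝ) ^ i) hq1 hqN hδh0 hδh1 le_rfl zero_le_one x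
    simp only [neg_zero, Real.rpow_zero, one_mul, mul_one] at hSum
    have hid : ((L : ℝ) ^ (d + 1)) ^ i = ((L : ℝ) ^ i) ^ (d + 1) := by rw [← pow_mul, ← pow_mul, Nat.mul_comm]
    -- on the far set the exponential splits off the factor `e^{−(δ₁∕2)L^mL^i∕n′} = e^{−(δ₁∕2)L^i∕L^k}`
    have hfac : ∀ y ∈ univ.filter (fun y => ((L ^ m : ℕ) : ℝ) ≤ tdistT (fine (L ^ m * L ^ k) M) x y), Real.exp (-(δ₁ * (tdistT (fine (L ^ m * L ^ k) M) x y * (L : ℝ) ^ i / ((L ^ m * L ^ k : ℕ) : ℝ))))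
        ≤ Real.exp (-(δ₁ / 2 * ((L : ℝ) ^ i / (L : ℝ) ^ k))) * Real.exp (-(δ₁ / 2 * (tdistT (fine (L ^ m * L ^ k) M) x y * (L : ℝ) ^ i / ((L ^ m * L ^ k : ℕ) : ℝ)))) := by
      intro y hy
      have hfar : ((L ^ m : ℕ) : ℝ) ≤ tdistT (fine (L ^ m * L ^ k) M) x y := (mem_filter.mp hy).2
      rw [← Real.exp_add, Real.exp_le_exp]
      have hratio : (L : ℝ) ^ i / (L : ℝ) ^ k = (L : ℝ) ^ m * (L : ℝ) ^ i / ((L ^ m * L ^ k : ℕ) : ℝ) := by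
        rw [hn'mk]
        have hLk : (L : ℝ) ^ k ≠ 0 := pow_ne_zero _ hL0.ne'
        have hLm0 : (L : ℝ) ^ m ≠ 0 := pow_ne_zero _ hL0.ne'
        field_simp
      rw [hratio]
      rw [hLm] at hfar
      have h0 : 0 ≤ (L : ℝ) ^ i / ((L ^ m * L ^ k : ℕ) : ℝ) := by positivity
      have key : (L : ℝ) ^ m * (L : ℝ) ^ i / ((L ^ m * L ^ k : ℕ) : ℝ) ≤ tdistT (fine (L ^ m * L ^ k) M) x y * (L : ℝ) ^ i / ((L ^ m * L ^ k : ℕ) : ℝ) := by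
        rw [mul_div_assoc, mul_div_assoc]
        exact mul_le_mul_of_nonneg_right hfar h0
      nlinarith
    calc ∑ y ∈ univ.filter (fun y => ((L ^ m : ℕ) : ℝ) ≤ tdistT (fine (L ^ m * L ^ k) M) x y), ((L : ℝ) ^ (d + 1)) ^ i * Real.exp (-(δ₁ * (tdistT (fine (L ^ m * L ^ k) M) x y * (L : ℝ) ^ i / ((L ^ m * L ^ k : ℕ) : ℝ))))
        ≤ ∑ y ∈ univ.filter (fun y => ((L ^ m : ℕ) : ℝ) ≤ tdistT (fine (L ^ m * L ^ k) M) x y), ((L : ℝ) ^ (d + 1)) ^ i * (Real.exp (-(δ₁ / 2 * ((L : ℝ) ^ i / (L : ℝ) ^ k)))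
            * Real.exp (-(δ₁ / 2 * (tdistT (fine (L ^ m * L ^ k) M) x y * (L : ℝ) ^ i / ((L ^ m * L ^ k : ℕ) : ℝ))))) :=
          Finset.sum_le_sum fun y hy => mul_le_mul_of_nonneg_left (hfac y hy) (by positivity)
      _ ≤ ∑ y, ((L : ℝ) ^ (d + 1)) ^ i * (Real.exp (-(δ₁ / 2 * ((L : ℝ) ^ i / (L : ℝ) ^ k)))
            * Real.exp (-(δ₁ / 2 * (tdistT (fine (L ^ m * L ^ k) M) x y * (L : ℝ) ^ i / ((L ^ m * L ^ k : ℕ) : ℝ))))) :=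
          Finset.sum_le_sum_of_subset_of_nonneg (Finset.filter_subset _ _) fun y _ _ => by positivity
      _ = ((L : ℝ) ^ (d + 1)) ^ i * Real.exp (-(δ₁ / 2 * ((L : ℝ) ^ i / (L : ℝ) ^ k)))
            * ∑ y, Real.exp (-(δ₁ / 2 * (tdistT (fine (L ^ m * L ^ k) M) x y * (L : ℝ) ^ i / ((L ^ m * L ^ k : ℕ) : ℝ)))) := by
          rw [Finset.mul_sum]
          exact Finset.sum_congr rfl fun y _ => by ring
      _ ≤ ((L : ℝ) ^ (d + 1)) ^ i * Real.exp (-(δ₁ / 2 * ((L : ℝ) ^ i / (L : ℝ) ^ k)))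
            * (2 * (8 * ((d : ℝ) + 1) * ((L ^ m * L ^ k : ℕ) : ℝ) / (δ₁ / 2 * (L : ℝ) ^ i)) ^ (d + 1)) :=
          mul_le_mul_of_nonneg_left hSum (by positivity)
      _ = 2 * Real.exp (-(δ₁ / 2 * ((L : ℝ) ^ i / (L : ℝ) ^ k))) * (((L : ℝ) ^ i) ^ (d + 1) * (8 * ((d : ℝ) + 1) * ((L ^ m * L ^ k : ℕ) : ℝ) / (δ₁ / 2 * (L : ℝ) ^ i)) ^ (d + 1)) := by
          rw [hid]; ring
      _ = 2 * (2 * (8 * ((d : ℝ) + 1)) / δ₁) ^ (d + 1) * ((L ^ m * L ^ k : ℕ) : ℝ) ^ (d + 1) * Real.exp (-(δ₁ / 2 * ((L : ℝ) ^ i / (L : ℝ) ^ k))) := by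
          rw [level_alg_far (d := d) hq0 hδ0]; ring
  calc ∑ i ∈ range (k + m), ∑ y ∈ univ.filter (fun y => ((L ^ m : ℕ) : ℝ) ≤ tdistT (fine (L ^ m * L ^ k) M) x y),
          ((L : ℝ) ^ (d + 1)) ^ i * Real.exp (-(δ₁ * (tdistT (fine (L ^ m * L ^ k) M) x y * (L : ℝ) ^ i / ((L ^ m * L ^ k : ℕ) : ℝ))))
      ≤ ∑ i ∈ range (k + m), 2 * (2 * (8 * ((d : ℝ) + 1)) / δ₁) ^ (d + 1) * ((L ^ m * L ^ k : ℕ) : ℝ) ^ (d + 1) * Real.exp (-(δ₁ / 2 * ((L : ℝ) ^ i / (L : ℝ) ^ k))) :=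
        Finset.sum_le_sum hlev
    _ = 2 * (2 * (8 * ((d : ℝ) + 1)) / δ₁) ^ (d + 1) * ((L ^ m * L ^ k : ℕ) : ℝ) ^ (d + 1) * ∑ i ∈ range (k + m), Real.exp (-(δ₁ / 2 * ((L : ℝ) ^ i / (L : ℝ) ^ k))) := by
        rw [Finset.mul_sum]
    _ ≤ 2 * (2 * (8 * ((d : ℝ) + 1)) / δ₁) ^ (d + 1) * ((L ^ m * L ^ k : ℕ) : ℝ) ^ (d + 1) * (((k : ℝ) + 1) + (1 - Real.exp (-(δ₁ / 2)))⁻¹) :=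
        mul_le_mul_of_nonneg_left (levelFar_sum_le L hL (by linarith) k (k + m)) (by positivity)
    _ ≤ 2 * (2 * (8 * ((d : ℝ) + 1)) / δ₁) ^ (d + 1) * (1 + (1 - Real.exp (-(δ₁ / 2)))⁻¹) * ((k : ℝ) + 2) * ((L ^ m * L ^ k : ℕ) : ℝ) ^ (d + 1) := by
        have hinv : 0 ≤ (1 - Real.exp (-(δ₁ / 2)))⁻¹ := inv_nonneg.mpr hr0.le
        have hk0 : (0 : ℝ) ≤ k := Nat.cast_nonneg k
        have hA : 0 ≤ 2 * (2 * (8 * ((d : ℝ) + 1)) / δ₁) ^ (d + 1) * ((L ^ m * L ^ k : ℕ) : ℝ) ^ (d + 1) := by positivity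
        have hle : ((k : ℝ) + 1) + (1 - Real.exp (-(δ₁ / 2)))⁻¹ ≤ (1 + (1 - Real.exp (-(δ₁ / 2)))⁻¹) * ((k : ℝ) + 2) := by nlinarith
        calc 2 * (2 * (8 * ((d : ℝ) + 1)) / δ₁) ^ (d + 1) * ((L ^ m * L ^ k : ℕ) : ℝ) ^ (d + 1) * (((k : ℝ) + 1) + (1 - Real.exp (-(δ₁ / 2)))⁻¹)
            ≤ 2 * (2 * (8 * ((d : ℝ) + 1)) / δ₁) ^ (d + 1) * ((L ^ m * L ^ k : ℕ) : ℝ) ^ (d + 1) * ((1 + (1 - Real.exp (-(δ₁ / 2)))⁻¹) * ((k : ℝ) + 2)) :=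
              mul_le_mul_of_nonneg_left hle hA
          _ = _ := by ring


end Summit.QuantumFields.YangMills.BalabanUVNodes.N15.KingModel.CellOsc
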